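import Mathlib
import Summits.NavierStokesRegularity.NavierStokesRegularity.Theorems.ThreadingFluxHorizonTowerMixedDegreeRigidity
import Summits.NavierStokesRegularity.NavierStokesRegularity.Theorems.ThreadingFluxLoopLawSameDegreeBracketRigidity
import Summits.NavierStokesRegularity.NavierStokesRegularity.Theorems.ThreadingFluxPlatonicSymmetryAlgebra
import HarnessLib

/-!
# Crux `PoloidalLiouville` (stmt-NavierStokesRegularity-1222, wall W1), crux idea «platonic-germ-sieve» (ns-idea-15 g11, critic V27):
# THE PLATONIC SELECTION LEMMA, EVERY DEGREE — the Poisson-commutant of an O-invariant solid harmonic is trivial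

Support file (`--supports stmt-NavierStokesRegularity-1222`, helper; cell `ns-wall-extremal`, width hand ns-wall-eng-7 g10; 0 kit).
This is the custodian's RESULTS v7 §7 (v) item «Lean: the Selection Lemma … is a formalizable statement»
(`Cruxes/PoloidalLiouville/PlatonicSieveResults.md` §4, §11, §13c, §15, §17), proved here ONCE FOR EVERY DEGREE:

* ★ `Platonic.invariantHarmonic_eq_zero_of_zonal` — a real solid harmonic `A` (homogeneous polynomial of degree `l ≥ 1` on `ℝ³` with
  `ΔA = 0`) which is INVARIANT under the rotation group O of the cube (`octahedral`) and infinitesimally ZONAL about some axis `n ≠ 0`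
  (`⟪n × x, ∇A(x)⟫ ≡ 0`) is `0`.  Proof: encode `A` in the radial field `W = A·x`; `W` is O-equivariant and rotation-equivariant
  about `n`, so by ns-wall-eng-8's spanning theorem `fderiv_cross_all_of_octahedral` (p722437, BY NAME) it is rotation-equivariant
  about EVERY axis, i.e. `x × ∇A ≡ 0`; then the polynomial Euler–Laplace identity `|x|²·ΔA = l(l+1)·A` kills `A`.
* ★★ `Platonic.selectionLemma` — **for an O-invariant real solid harmonic `h ≠ 0` of degree `l₀ ≥ 1` and ANY real solid harmonic `Y`
  of degree `l ≥ 1` (invariant or not, either parity) whose loop/Poisson bracket `⟪y, ∇h(y) × ∇Y(y)⟫` vanishes identically: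
  `l ≠ l₀ ⇒ Y = 0`, and `l = l₀ ⇒ Y = c·h`.**  BY NAME on ns-wall-eng-3's ★★★ `Zonal.mixedDegreeBracketRigidity` (p690637: different
  degrees ⇒ coaxially zonal — impossible for `h` by the first theorem) and `LoopLaw.sameDegreeBracketRigidity` (p684047).
* `Platonic.selectionLemma_offDegree` / `Platonic.selectionLemma_sameDegree` — the two halves separately, and
  `Platonic.invariant_of_cubeRotationData` — the card's binder form of O-invariance (`∀ σ s, IsCubeRotationData σ s → …`) gives the
  `octahedral` form used here.

READING for the card (custodian's words, RESULTS v7 §11): the UNIFORM-MECHANISM CONJECTURE part (i) — «for every m and every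
h ∈ 𝓗^O_{m+1} ∖ 0 the Poisson-commutant of h in ⊕_{l ≠ 0, m+1} 𝓗_l is trivial» — is hereby a kernel THEOREM for every `m` (degree-wise,
which is all that is used: `{h, Y_l}` has degree `m + l` so the commutant splits by degree); it replaces the exact-rank tables
(l ≤ 22 / 26 / 27 / 28 / 32 for h₄, h₆, h₈, h₁₀, the pencil 𝓗^O_12, h₁₄, I₉) and the ODE argument with its input `J(h, |∇h|²) ≢ 0`.
Every non-zero point of a pencil of O-invariant harmonics is O-invariant, so there is no exceptional set (§13c) by construction.
Part (ii) of that conjecture (`{h, Y} ≠ 0` for the quadratic self-interaction harmonic) and the cascade bookkeeping («first contact»)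
remain the custodian's exact engine; nothing here is an NS statement.

HONEST FRAME: finite-dimensional harmonic-polynomial algebra about ONE crux idea's mechanism, information-grade, strictly below W1;
W1 movement 0; `OctahedralCentreRigidity`, `PoloidalLiouville` (1222), `UnthreadedRigidity` (27585) and NS regularity are OPEN —
NOT proved.  [folklore]
-/

-- the summit and its single sub-problem share the name (CONVENTIONS §1)
set_option linter.dupNamespace false

noncomputable section

namespace Summit.NavierStokesRegularity.NavierStokesRegularity.Theorems.PoloidalLiouville.Platonic

open MvPolynomial
open scoped RealInnerProductSpace
open Literature.Analysis.FluidPDE (cross)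
open Summit.NavierStokesRegularity.NavierStokesRegularity.Theorems.PoloidalLiouville.CentreJet (E3)
open Summit.NavierStokesRegularity.NavierStokesRegularity.Theorems.PoloidalLiouville.HorizonTower
  (cross_fin3 inner_gradient_eq_fderiv)
open Summit.NavierStokesRegularity.NavierStokesRegularity.Theorems.PoloidalLiouville.HorizonTower.Zonal
  (evalE lapP evalE_zero evalE_X evalE_sub evalE_mul fderiv_evalE_apply hasFDerivAt_evalE differentiable_evalE laplacian_evalE
    eq_zero_of_evalE_eq_zero euler3 mixedDegreeBracketRigidity)
open Summit.NavierStokesRegularity.NavierStokesRegularity.Theorems.PoloidalLiouville.LoopLaw (sameDegreeBracketRigidity)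

/-! ### O-invariance in the card's binder form -/

/-- The card's binder form of O-invariance of a scalar (`∀ σ s, IsCubeRotationData σ s → f (cubeRot σ s x) = f x`, as in
`OctahedralCentreRigidity`) gives invariance under the set `octahedral`. -/
theorem invariant_of_cubeRotationData {f : E3 → ℝ}
    (h : ∀ (σ : Equiv.Perm (Fin 3)) (s : Fin 3 → ℝ), IsCubeRotationData σ s → ∀ x, f (cubeRot σ s x) = f x) :
    ∀ g ∈ octahedral, ∀ x, f (g x) = f x := by
  rintro g ⟨σ, s, hd, rfl⟩ x
  exact h σ s hd x

/-! ### An O-invariant solid harmonic is zonal about no axis -/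

/-- The rotation generators of a polynomial function in coordinates: `DA(x)[c × x] = Σᵢ (∂ᵢA)(x) (c × x)ᵢ`, written out. -/
theorem fderiv_evalE_cross (A : MvPolynomial (Fin 3) ℝ) (c x : E3) :
    fderiv ℝ (evalE A) x (cross c x) =
      evalE (pderiv 0 A) x * (c 1 * x 2 - c 2 * x 1) + evalE (pderiv 1 A) x * (c 2 * x 0 - c 0 * x 2)
        + evalE (pderiv 2 A) x * (c 0 * x 1 - c 1 * x 0) := by
  obtain ⟨c0, c1, c2⟩ := cross_fin3 c x
  rw [fderiv_evalE_apply, Fin.sum_univ_three, c0, c1, c2]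

/-- **The polynomial Euler–Laplace identity for a radial gradient.**  If `A` is homogeneous of degree `l` and its gradient is radial as a
polynomial identity (`xᵢ ∂ⱼA = xⱼ ∂ᵢA`), then `l(l+1)·A = |x|²·ΔA`. [folklore] -/
theorem euler_laplace_of_radial {A : MvPolynomial (Fin 3) ℝ} {l : ℕ} (hA : A.IsHomogeneous l)
    (hr0 : X 1 * pderiv 2 A - X 2 * pderiv 1 A = 0) (hr1 : X 2 * pderiv 0 A - X 0 * pderiv 2 A = 0)
    (hr2 : X 0 * pderiv 1 A - X 1 * pderiv 0 A = 0) :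
    C ((l : ℝ) * (l + 1)) * A = (X 0 * X 0 + X 1 * X 1 + X 2 * X 2) * lapP A := by
  have hE := euler3 hA
  -- `|x|² ∂ⱼA = l xⱼ A`
  have hρ0 : (X 0 * X 0 + X 1 * X 1 + X 2 * X 2) * pderiv 0 A = C (l : ℝ) * X 0 * A := by
    linear_combination X 0 * hE - X 1 * hr2 + X 2 * hr1
  have hρ1 : (X 0 * X 0 + X 1 * X 1 + X 2 * X 2) * pderiv 1 A = C (l : ℝ) * X 1 * A := by
    linear_combination X 1 * hE + X 0 * hr2 - X 2 * hr0
  have hρ2 : (X 0 * X 0 + X 1 * X 1 + X 2 * X 2) * pderiv 2 A = C (l : ℝ) * X 2 * A := by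
    linear_combination X 2 * hE - X 0 * hr1 + X 1 * hr0
  -- differentiate each along its own coordinate
  have d0 := congrArg (pderiv 0) hρ0
  have d1 := congrArg (pderiv 1) hρ1
  have d2 := congrArg (pderiv 2) hρ2
  simp only [pderiv_mul, pderiv_C, pderiv_X_self, pderiv_X_of_ne (show (1 : Fin 3) ≠ 0 by decide),
    pderiv_X_of_ne (show (2 : Fin 3) ≠ 0 by decide), pderiv_X_of_ne (show (0 : Fin 3) ≠ 1 by decide),
    pderiv_X_of_ne (show (2 : Fin 3) ≠ 1 by decide), pderiv_X_of_ne (show (0 : Fin 3) ≠ 2 by decide),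
    pderiv_X_of_ne (show (1 : Fin 3) ≠ 2 by decide), map_add] at d0 d1 d2
  unfold lapP
  rw [show C ((l : ℝ) * (l + 1)) = C (l : ℝ) * (C (l : ℝ) + 1) by rw [map_mul, map_add, map_one]]
  linear_combination -(d0 + d1 + d2) + (2 - C (l : ℝ)) * hE

/-- A homogeneous HARMONIC polynomial of degree `l ≥ 1` with radial gradient (`xᵢ ∂ⱼA = xⱼ ∂ᵢA`) is `0`. [folklore] -/
theorem eq_zero_of_radial_harmonic {A : MvPolynomial (Fin 3) ℝ} {l : ℕ} (hl : 1 ≤ l) (hA : A.IsHomogeneous l) (hlap : lapP A = 0)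
    (hr0 : X 1 * pderiv 2 A - X 2 * pderiv 1 A = 0) (hr1 : X 2 * pderiv 0 A - X 0 * pderiv 2 A = 0)
    (hr2 : X 0 * pderiv 1 A - X 1 * pderiv 0 A = 0) : A = 0 := by
  have h := euler_laplace_of_radial hA hr0 hr1 hr2
  rw [hlap, mul_zero, C_mul'] at h
  have hc : ((l : ℝ) * (l + 1)) ≠ 0 := by positivity
  exact (smul_eq_zero.mp h).resolve_left hc

/-- ★ **An O-invariant real solid harmonic is zonal about no axis.**  `A` homogeneous of degree `l ≥ 1`, `ΔA = 0`, invariant under the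
rotation group of the cube, and `⟪n × x, ∇A(x)⟫ = 0` for all `x` with `n ≠ 0` ⇒ `A = 0`.  (Radial encoding `W = A·x` + eng-8's spanning
theorem `fderiv_cross_all_of_octahedral` ⇒ `x × ∇A ≡ 0`; then `eq_zero_of_radial_harmonic`.) -/
theorem invariantHarmonic_eq_zero_of_zonal (l : ℕ) (A : MvPolynomial (Fin 3) ℝ) (hl : 1 ≤ l)
    (hA : A.IsHomogeneous l ∧ ∀ y : E3, Laplacian.laplacian (evalE A) y = 0)
    (hinv : ∀ g ∈ octahedral, ∀ x, evalE A (g x) = evalE A x)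
    {n : E3} (hn : n ≠ 0) (hzonal : ∀ x : E3, ⟪cross n x, gradient (evalE A) x⟫ = 0) : A = 0 := by
  obtain ⟨hAh, hAlap⟩ := hA
  -- the radial field `W = A · x`
  set W : E3 → E3 := fun x => evalE A x • x with hW
  have hWd : ∀ x, HasFDerivAt W (evalE A x • ContinuousLinearMap.id ℝ E3 +
      (fderiv ℝ (evalE A) x).smulRight x) x := by
    intro x
    have h1 : HasFDerivAt (evalE A) (fderiv ℝ (evalE A) x) x := (differentiable_evalE A x).hasFDerivAt
    exact h1.smul (hasFDerivAt_id x)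
  have hWdiff : Differentiable ℝ W := fun x => (hWd x).differentiableAt
  have hWapply : ∀ x v, fderiv ℝ W x v = evalE A x • v + (fderiv ℝ (evalE A) x v) • x := by
    intro x v
    rw [(hWd x).fderiv]
    simp
  have hcross_smul : ∀ (c : E3) (r : ℝ) (x : E3), cross c (r • x) = r • cross c x := fun c r x => by
    ext i; fin_cases i <;> simp [cross, crossProduct]
  -- `W` is O-equivariant
  have hequi : IsEquivariant octahedral W := by
    rintro g ⟨σ, s, hd, rfl⟩ x
    show evalE A (cubeRot σ s x) • cubeRot σ s x = cubeRot σ s (evalE A x • x)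
    rw [hinv _ ⟨σ, s, hd, rfl⟩ x, cubeRot_smul]
  -- `W` is rotation-equivariant about `n`
  have hPn : ∀ x, fderiv ℝ W x (cross n x) = cross n (W x) := by
    intro x
    have hz : fderiv ℝ (evalE A) x (cross n x) = 0 := by rw [← inner_gradient_eq_fderiv, real_inner_comm]; exact hzonal x
    rw [hWapply, hz, zero_smul, add_zero, hW, hcross_smul]
  -- hence about every axis (eng-8's spanning theorem, by name)
  have hall := fderiv_cross_all_of_octahedral hWdiff hequi hn hPn
  -- decode: `DA(x)[c × x] = 0` for all `c`, `x`
  have hrot : ∀ c x : E3, fderiv ℝ (evalE A) x (cross c x) = 0 := by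
    intro c x
    have h := hall c x
    rw [hWapply, hW, hcross_smul, add_eq_left, smul_eq_zero] at h
    rcases h with h | h
    · exact h
    · rw [h]
      have : cross c (0 : E3) = 0 := by ext i; fin_cases i <;> simp [cross, crossProduct]
      rw [this, map_zero]
  -- the three polynomial rotation generators vanish
  set e : Fin 3 → E3 := fun i => EuclideanSpace.single i (1 : ℝ) with he
  have hr0 : X 1 * pderiv 2 A - X 2 * pderiv 1 A = 0 := by
    refine eq_zero_of_evalE_eq_zero fun x => ?_
    have h := hrot (e 0) x
    rw [fderiv_evalE_cross] at h
    simp [he] at h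
    simp only [evalE_sub, evalE_mul, evalE_X]
    linear_combination h
  have hr1 : X 2 * pderiv 0 A - X 0 * pderiv 2 A = 0 := by
    refine eq_zero_of_evalE_eq_zero fun x => ?_
    have h := hrot (e 1) x
    rw [fderiv_evalE_cross] at h
    simp [he] at h
    simp only [evalE_sub, evalE_mul, evalE_X]
    linear_combination h
  have hr2 : X 0 * pderiv 1 A - X 1 * pderiv 0 A = 0 := by
    refine eq_zero_of_evalE_eq_zero fun x => ?_
    have h := hrot (e 2) x
    rw [fderiv_evalE_cross] at h
    simp [he] at h
    simp only [evalE_sub, evalE_mul, evalE_X]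
    linear_combination h
  -- harmonic as a polynomial
  have hlapA : lapP A = 0 := eq_zero_of_evalE_eq_zero fun y => by rw [← laplacian_evalE]; exact hAlap y
  exact eq_zero_of_radial_harmonic hl hAh hlapA hr0 hr1 hr2

/-! ### The Selection Lemma -/

/-- **Selection, off the lead degree.**  `h` an O-invariant solid harmonic of degree `l₀ ≥ 1`, `h ≠ 0`; `Y` a solid harmonic of degree
`l ≥ 1`, `l ≠ l₀`, with `⟪y, ∇h(y) × ∇Y(y)⟫ = 0` for all `y` ⇒ `Y = 0`.  (If `Y ≠ 0`, `Zonal.mixedDegreeBracketRigidity` makes `h` zonal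
about some axis, contradicting `invariantHarmonic_eq_zero_of_zonal`.) -/
theorem selectionLemma_offDegree (l₀ l : ℕ) (h Y : MvPolynomial (Fin 3) ℝ) (hl₀ : 1 ≤ l₀) (hl : 1 ≤ l) (hne : l ≠ l₀)
    (hh : h.IsHomogeneous l₀ ∧ ∀ y : E3, Laplacian.laplacian (evalE h) y = 0)
    (hY : Y.IsHomogeneous l ∧ ∀ y : E3, Laplacian.laplacian (evalE Y) y = 0)
    (hh0 : h ≠ 0) (hinv : ∀ g ∈ octahedral, ∀ x, evalE h (g x) = evalE h x)
    (hbr : ∀ y : E3, ⟪y, cross (gradient (evalE h) y) (gradient (evalE Y) y)⟫ = 0) : Y = 0 := by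
  by_contra hY0
  obtain ⟨n, hn, hzon, -⟩ := mixedDegreeBracketRigidity l₀ l h Y hl₀ hl (Ne.symm hne) hh hY hh0 hY0 hbr
  exact hh0 (invariantHarmonic_eq_zero_of_zonal l₀ h hl₀ hh hinv hn hzon)

/-- **Selection, at the lead degree.**  `h` an O-invariant solid harmonic of degree `l₀ ≥ 1`, `h ≠ 0`; `Y` a solid harmonic of the SAME
degree with vanishing bracket ⇒ `Y = c·h` (`LoopLaw.sameDegreeBracketRigidity`, by name; O-invariance is not needed here). -/
theorem selectionLemma_sameDegree (l₀ : ℕ) (h Y : MvPolynomial (Fin 3) ℝ) (hl₀ : 1 ≤ l₀)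
    (hh : h.IsHomogeneous l₀ ∧ ∀ y : E3, Laplacian.laplacian (evalE h) y = 0)
    (hY : Y.IsHomogeneous l₀ ∧ ∀ y : E3, Laplacian.laplacian (evalE Y) y = 0)
    (hh0 : h ≠ 0)
    (hbr : ∀ y : E3, ⟪y, cross (gradient (evalE h) y) (gradient (evalE Y) y)⟫ = 0) : ∃ c : ℝ, Y = c • h :=
  sameDegreeBracketRigidity l₀ h Y hl₀ hh hY hh0 hbr

/-- ★★ **THE PLATONIC SELECTION LEMMA, EVERY DEGREE** (RESULTS v7 §4 for `l₀ ∈ {4, 6, 8}`, §11 `h₁₀`, §13c the pencil `𝓗^O_12`, §15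
`h₁₄`, §17 `I₉`, … at once): `h` an O-invariant real solid harmonic of degree `l₀ ≥ 1`, `h ≠ 0`; `Y` ANY real solid harmonic of degree
`l ≥ 1` whose loop/Poisson bracket with `h` vanishes identically.  Then `Y = 0` if `l ≠ l₀`, and `Y ∈ ℝ·h` if `l = l₀`.  In the
custodian's words: the Poisson-commutant of `h` in `⊕_{l ∉ {0, l₀}} 𝓗_l` is trivial and in `𝓗_{l₀}` it is the line of `h` — the
UNIFORM-MECHANISM CONJECTURE part (i), for every lead degree. -/
theorem selectionLemma (l₀ l : ℕ) (h Y : MvPolynomial (Fin 3) ℝ) (hl₀ : 1 ≤ l₀) (hl : 1 ≤ l)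
    (hh : h.IsHomogeneous l₀ ∧ ∀ y : E3, Laplacian.laplacian (evalE h) y = 0)
    (hY : Y.IsHomogeneous l ∧ ∀ y : E3, Laplacian.laplacian (evalE Y) y = 0)
    (hh0 : h ≠ 0) (hinv : ∀ g ∈ octahedral, ∀ x, evalE h (g x) = evalE h x)
    (hbr : ∀ y : E3, ⟪y, cross (gradient (evalE h) y) (gradient (evalE Y) y)⟫ = 0) :
    (l ≠ l₀ → Y = 0) ∧ (l = l₀ → ∃ c : ℝ, Y = c • h) := by
  refine ⟨fun hne => selectionLemma_offDegree l₀ l h Y hl₀ hl hne hh hY hh0 hinv hbr, fun heq => ?_⟩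
  subst heq
  exact selectionLemma_sameDegree l h Y hl₀ hh hY hh0 hbr

end Summit.NavierStokesRegularity.NavierStokesRegularity.Theorems.PoloidalLiouville.Platonic

end
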